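/-
Origin: expansion seat `planner-pub-hodgecm-pv04-g6-0`, handover #5 2026-08-18T09:43:25Z (`HOME/pub-hodgecm-pv04-g6/lean/Pv04g6/CMInflationIndependentAll.lean`, md5 aba021c4, 89 lines);
landed by the gen-7 packager in gate run 28 as `HodgeCM/Model/Toy/CMInflationIndependentAll.lean` (import ^import Pv04g6\.CMInflationIndependentBlocks\b→import HodgeCM.Model.Toy.CMInflationIndependentBlocks ×1).
-/
/-
Copyright: pub-hodgecm cell (HodgeCMPerL). Consistency-witness layer (part (e)); FACTS.md §1c row (M38), column P5.
Origin: HOME/pub-hodgecm-pv04-g6/lean/Pv04g6/CMInflationIndependentAll.lean (WIP module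
`Pv04g6.CMInflationIndependentAll`; intended final place `HodgeCM/Model/Toy/CMInflationIndependentAll.lean` =
module `HodgeCM.Model.Toy.CMInflationIndependentAll`, CONTRIBUTING §3 kind L5) (seat planner-pub-hodgecm-pv04-g6-0,
DAG-node prover #04 gen 6, seam S6 / fact row M38).
WIP import to rewrite on landing: `import Pv04g6.CMInflationIndependentBlocks` ↦ `import HodgeCM.Model.Toy.CMInflationIndependentBlocks`.
-/
import Summits.HodgeConjecture.HodgeCM.Model.Toy.CMInflationIndependentBlocks
import Summits.HodgeConjecture.HodgeCM.Model.Toy.ToyUnitH0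

/-!
# M38 is independent of every numbered §1c fact of the exterior toy universe

Adds F-H0 `Fact_unitH0` (M43) and F7d-B `Fact_gysinDescentB` to `CMInflationIndependentBlocks.lean`:
F-H0 mentions morphisms only through the universal clause `f^* 1_Y = 1_X`, so it passes to any morphism restriction
(`restrict_fact_unitH0`); F7d-B is clause (b) of F7d (`Universe.gysinDescentB_of_gysinDescent`).  Hence
(`cmInflation_independent_all`)

  `∃ U, (U.ModelAxioms ∧ N1 ∧ N2 ∧ N3 ∧ N4 ∧ F2 ∧ F4 ∧ F5 ∧ F7 ∧ F7d ∧ F7d-B ∧ F-H0 ∧ D ∧ Fact_H0_rank) ∧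
     ¬ U.Fact_cmInflation`:

M38 `Fact_cmInflation` is independent of M1–M28 ∧ N1–N4 ∧ F2 ∧ F4 ∧ F5 ∧ F7 ∧ M41 ∧ F7d-B ∧ M43 ∧ M40 ∧ M42 jointly —
of every candidate model fact of `HOME/FACTS.md` §1c holding in the exterior toy universe `toyModel` (F6 `Fact_weightDual`,
T `Fact_trTop` and T-CM `Fact_trTopCM` are false there, `Model/Toy/ToyTrTop.lean`).
-/

noncomputable section

namespace HodgeCM

namespace Universe

variable (U : Universe) (C : U.MorClass)

/-- F-H0 (M43) transfers to any morphism restriction (same unit classes). -/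
theorem restrict_fact_unitH0 (h : U.Fact_unitH0) : (U.restrict C).Fact_unitH0 := by
  obtain ⟨one, h1, h2, h3⟩ := h
  refine ⟨one, fun X Y f => h1 X Y f.1, h2, fun F n Θ => ?_⟩
  rw [restrict_cmProd]
  exact h3 F n Θ

end Universe

namespace Toy

open CMInflationIndependent

/-- The tagged exterior toy universe satisfies F-H0 (M43) and F7d-B. -/
theorem tagModel_unitH0_descentB :
    (tagModel exteriorHodgeData).Fact_unitH0 ∧ (tagModel exteriorHodgeData).Fact_gysinDescentB :=
  ⟨(toyModelWith exteriorHodgeData).restrict_fact_unitH0 _ (fact_unitH0 exteriorHodgeData),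
    Universe.gysinDescentB_of_gysinDescent tagModel_blocks.2.2⟩

/-- **M38 is independent of M1–M28 ∧ N1–N4 ∧ F2 ∧ F4 ∧ F5 ∧ F7 ∧ F7d (M41) ∧ F7d-B ∧ F-H0 (M43) ∧ D (M40) ∧
`Fact_H0_rank` (M42), jointly** — of every numbered candidate model fact of `HOME/FACTS.md` §1c holding in the exterior
toy universe. -/
theorem cmInflation_independent_all :
    ∃ U : Universe, (U.ModelAxioms ∧ U.Fact_cupExterior ∧ U.Fact_cup_hodge ∧ U.Fact_pull_H0 ∧ U.Fact_hodge_F0 ∧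
      U.Fact_factorActDescends ∧ U.Fact_cupAlg ∧ U.Fact_cupAssoc ∧ U.Fact_gysin ∧ U.Fact_gysinDescent ∧
      U.Fact_gysinDescentB ∧ U.Fact_unitH0 ∧ U.Fact_dimProd ∧ U.Fact_H0_rank) ∧ ¬ U.Fact_cmInflation :=
  have h := tagModel_ledger
  have b := tagModel_blocks
  have c := tagModel_unitH0_descentB
  ⟨tagModel exteriorHodgeData, ⟨h.1, h.2.1, h.2.2.1, h.2.2.2.1, h.2.2.2.2.1, b.1, h.2.2.2.2.2.1, h.2.2.2.2.2.2.1, b.2.1,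
    b.2.2, c.2, c.1, h.2.2.2.2.2.2.2.1, h.2.2.2.2.2.2.2.2⟩, not_fact_cmInflation exteriorHodgeData⟩

/-- the same universe also shows that the JOINT list is consistent (drop the last conjunct) and — with
`Toy.fact_cmInflation` in the untagged toy — that M38 is undecided by it: -/
theorem cmInflation_undecided_all :
    (∃ U : Universe, (U.ModelAxioms ∧ U.Fact_cupExterior ∧ U.Fact_cup_hodge ∧ U.Fact_pull_H0 ∧ U.Fact_hodge_F0 ∧
      U.Fact_factorActDescends ∧ U.Fact_cupAlg ∧ U.Fact_cupAssoc ∧ U.Fact_gysin ∧ U.Fact_gysinDescent ∧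
      U.Fact_gysinDescentB ∧ U.Fact_unitH0 ∧ U.Fact_dimProd ∧ U.Fact_H0_rank) ∧ U.Fact_cmInflation) ∧
    (∃ U : Universe, (U.ModelAxioms ∧ U.Fact_cupExterior ∧ U.Fact_cup_hodge ∧ U.Fact_pull_H0 ∧ U.Fact_hodge_F0 ∧
      U.Fact_factorActDescends ∧ U.Fact_cupAlg ∧ U.Fact_cupAssoc ∧ U.Fact_gysin ∧ U.Fact_gysinDescent ∧
      U.Fact_gysinDescentB ∧ U.Fact_unitH0 ∧ U.Fact_dimProd ∧ U.Fact_H0_rank) ∧ ¬ U.Fact_cmInflation) :=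
  ⟨⟨toyModelWith exteriorHodgeData, ⟨toyModel_modelAxioms, fact_cupExterior _, fact_cup_hodge, fact_pull_H0 _,
      fact_hodge_F0, fact_factorActDescends _, fact_cupAlg, fact_cupAssoc _, fact_gysin _, fact_gysinDescent,
      fact_gysinDescentB, fact_unitH0 _, fact_dimProd _, fact_H0_rank _⟩, fact_cmInflation _⟩,
    cmInflation_independent_all⟩

/-! Axiom closures of `HodgeCM.Toy.cmInflation_independent_all`, `HodgeCM.Toy.cmInflation_undecided_all`
(expected: `propext`, `Classical.choice`, `Quot.sound`). -/

end Toy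

end HodgeCM

end
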